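import Mathlib.RingTheory.DedekindDomain.AdicValuation
import Mathlib.RingTheory.DedekindDomain.Factorization
import Mathlib.NumberTheory.NumberField.Completion.FinitePlace
import Mathlib.NumberTheory.NumberField.Norm
import Mathlib.RingTheory.Ideal.Norm.AbsNorm
import Mathlib.RingTheory.Valuation.Integers
import Mathlib.Topology.Algebra.Ring.Compact
import Literature.NumberTheory.Automorphic.AdicCompletionCompact
import Literature.NumberTheory.GaloisRepresentations.LocalOneUnitsProofs
import HarnessLib

/-!
# `ℤ_p`-valued characters of the local units of a number field at `v ∣ p` (proofs only)

Topic `NumberTheory/GaloisRepresentations` (local fields at the places of a number field);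
namespace `Literature.OneUnits`.  No new definitions.

Let `K` be a number field, `p` a prime and `v` a finite place of `K` above `p`
(`(p) ⊆ v`), with valuation ring `𝒪_v = v.adicCompletionIntegers K ⊆ K_v`.  Then `𝒪_v` is a
compact Hausdorff discrete valuation ring in which `p ≠ 0` is a non-unit, so the abstract theorem
`Literature.NumberTheory.GaloisRepresentations.OneUnits.exists_continuousMonoidHom_forall_exists` applies:

* `exists_continuousMonoidHom_adicCompletionIntegers` : there are `n_v` continuous characters
  `𝒪_vˣ → ℤ_p`, `p^{n_v} = #(𝒪_v / p)`, with joint image containing `p^N ℤ_p^{n_v}` — the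
  statement `rank_{ℤ_p} U_{v} = [K_v : ℚ_p]` (Neukirch, *Algebraic Number Theory*, Ch. II (5.7);
  Washington, *Introduction to Cyclotomic Fields*, §13.1, proof of Thm. 13.4:
  "`U_{1,𝔭} ≃ (finite group) × ℤ_p^{[K_𝔭:ℚ_p]}`");

and the local degrees add up to the global one:

* `finrank_le_sum`, `sum_eq_finrank` : `[K : ℚ] = ∑_{v ∣ p} n_v`, from the bijection
  `𝓞_K / p ↪ ∏_{v ∣ p} 𝒪_v / p` (an element of `𝓞_K` divisible by `p` in every `𝒪_v`, `v ∣ p`, is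
  divisible by `p`: prime factorisation `(p) = ∏ v^{e_v}`), `#(𝓞_K/p) = p^{[K:ℚ]}`
  (`Ideal.absNorm`), and surjectivity by density + CRT (`exists_ringOfIntegers_valued_sub_le`,
  `exists_forall_algebraMap_sub_mem`) — i.e. `∑_{v ∣ p} [K_v : ℚ_p] = [K : ℚ]` (Neukirch, ANT,
  Ch. II (8.4); Washington, §13.1: "`∑_{𝔭∣p} [K_𝔭 : ℚ_p] = [K : ℚ]`");

* `eq_zero_of_forall_mem_span_pow`, `exists_continuousMonoidHom_adicCompletionIntegers_rank` :
  `⋂ p^m 𝒪_v = 0`, hence (abstract `exists_forall_pow_mul_eq_sum`) the exact rank: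
  every continuous `ψ : 𝒪_vˣ → ℤ_p` has `p^N ψ = ∑ cᵢ φᵢ`.

## References

* J. Neukirch, *Algebraic Number Theory*, Springer 1999, Ch. II (5.7), (8.4).
* L. C. Washington, *Introduction to Cyclotomic Fields*, 2nd ed., GTM 83, §13.1, Thm. 13.4.
-/

noncomputable section

open NumberField IsDedekindDomain

namespace Literature.NumberTheory.GaloisRepresentations

namespace OneUnits

universe u

variable (K : Type u) [Field K] [NumberField K] (v : HeightOneSpectrum (𝓞 K)) (p : ℕ)

/-- The valuation of a global integer in `𝒪_v ⊆ K_v` is its `v`-adic valuation. [folklore] -/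
theorem valued_algebraMap_adicCompletionIntegers (r : 𝓞 K) :
    Valued.v ((algebraMap (𝓞 K) (v.adicCompletionIntegers K) r : v.adicCompletion K)) =
      v.intValuation r := by
  rw [HeightOneSpectrum.algebraMap_adicCompletionIntegers_apply,
    HeightOneSpectrum.valuedAdicCompletion_eq_valuation', HeightOneSpectrum.valuation_of_algebraMap]

/-- The valuation of `p` in `𝒪_v` is the `v`-adic valuation of `p ∈ 𝓞_K`. [folklore] -/
theorem valued_natCast_adicCompletionIntegers :
    Valued.v (((p : v.adicCompletionIntegers K) : v.adicCompletionIntegers K) : v.adicCompletion K) =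
      v.intValuation (p : 𝓞 K) := by
  rw [← map_natCast (algebraMap (𝓞 K) (v.adicCompletionIntegers K)) p]
  exact valued_algebraMap_adicCompletionIntegers K v _

variable [Fact p.Prime]

/-- `p ≠ 0` in `𝒪_v` (characteristic zero). [folklore] -/
theorem natCast_ne_zero_adicCompletionIntegers : (p : v.adicCompletionIntegers K) ≠ 0 := by
  intro h
  have h1 := valued_natCast_adicCompletionIntegers K v p
  rw [h, ZeroMemClass.coe_zero, map_zero] at h1
  have hp0 : (p : 𝓞 K) ≠ 0 := by exact_mod_cast (Fact.out : p.Prime).ne_zero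
  exact (v.intValuation_ne_zero _ hp0) h1.symm

omit [Fact p.Prime] in
/-- If `v ∣ p` then `1 + p a` is a unit of the local ring `𝒪_v` (`p` lies in the maximal ideal).
[folklore] -/
theorem isUnit_one_add_natCast_mul (hv : (p : 𝓞 K) ∈ v.asIdeal) (a : v.adicCompletionIntegers K) :
    IsUnit (1 + (p : v.adicCompletionIntegers K) * a) := by
  rcases IsLocalRing.isUnit_or_isUnit_one_sub_self (-((p : v.adicCompletionIntegers K) * a)) with h | h
  · exfalso
    rw [IsUnit.neg_iff] at h
    have h1 := (Valuation.Integers.isUnit_iff_valuation_eq_one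
      (Valuation.valuationSubring.integers _)).1 h
    change Valued.v (((p : v.adicCompletionIntegers K) * a : v.adicCompletionIntegers K) :
      v.adicCompletion K) = 1 at h1
    rw [Subring.coe_mul, map_mul] at h1
    have hp1 : Valued.v (((p : v.adicCompletionIntegers K) : v.adicCompletionIntegers K) :
        v.adicCompletion K) < 1 := by
      rw [valued_natCast_adicCompletionIntegers]
      exact (v.intValuation_lt_one_iff_mem _).2 hv
    have ha1 : Valued.v ((a : v.adicCompletionIntegers K) : v.adicCompletion K) ≤ 1 := a.2
    have := mul_lt_one_of_lt_of_le hp1 ha1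
    rw [h1] at this
    exact lt_irrefl _ this
  · rwa [sub_neg_eq_add] at h

/-- **`ℤ_p`-valued characters of `𝒪_vˣ`, `v ∣ p`.**  For a finite place `v` of the number field
`K` above `p` there are `n_v` continuous characters `φᵢ : 𝒪_vˣ → ℤ_p`, where
`p^{n_v} = #(𝒪_v / p 𝒪_v)` (`= p^{[K_v:ℚ_p]}`), whose joint image contains `p^N ℤ_p^{n_v}`:
the unit group `U_v = 𝒪_vˣ` has `ℤ_p`-rank `[K_v : ℚ_p]`.  (Abstract theorem
`exists_continuousMonoidHom_forall_exists` applied to the compact DVR `𝒪_v`.)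
Ref: Neukirch, *Algebraic Number Theory*, Ch. II (5.7) (i); Washington, *Introduction to
Cyclotomic Fields*, §13.1, proof of Thm. 13.4. [folklore] -/
theorem exists_continuousMonoidHom_adicCompletionIntegers (hv : (p : 𝓞 K) ∈ v.asIdeal) :
    ∃ (n N : ℕ) (φ : Fin n → ((v.adicCompletionIntegers K)ˣ →ₜ* Multiplicative ℤ_[p])),
      Nat.card (v.adicCompletionIntegers K ⧸
        Ideal.span {(p : v.adicCompletionIntegers K)}) = p ^ n ∧
      ∀ x : Fin n → ℤ_[p], ∃ u : (v.adicCompletionIntegers K)ˣ, ∀ i,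
        (φ i u).toAdd = (p : ℤ_[p]) ^ N * x i := by
  haveI : CompactSpace (v.adicCompletionIntegers K) :=
    Literature.NumberTheory.Automorphic.compactSpace_adicCompletionIntegers' K v
  refine exists_continuousMonoidHom_forall_exists p (fun a ha => ?_)
    (isUnit_one_add_natCast_mul K v p hv) (fun m => ?_)
  · exact (mul_eq_zero.1 ha).resolve_left (natCast_ne_zero_adicCompletionIntegers K v p)
  · refine IsDedekindDomain.isOpen_of_ne_bot ?_
    rw [Ne, Ideal.span_singleton_eq_bot]
    exact pow_ne_zero _ (natCast_ne_zero_adicCompletionIntegers K v p)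

/-! ### The local degrees above `p` add up to `[K : ℚ]` -/

/-- **Divisibility by `p` is tested at the places above `p`.**  If `x ∈ 𝓞_K` is divisible by `p`
in `𝒪_v` for every `v ∣ p`, then `p ∣ x` in `𝓞_K` (prime factorisation `(p) = ∏_{v∣p} v^{e_v}`,
and `p 𝒪_v = 𝔭_v^{e_v}`).  Ref: Neukirch, *Algebraic Number Theory*, Ch. I §3 (3.3), Ch. II §8.
[folklore] -/
theorem mem_span_natCast_of_forall (x : 𝓞 K)
    (h : ∀ w : HeightOneSpectrum (𝓞 K), (p : 𝓞 K) ∈ w.asIdeal →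
      algebraMap (𝓞 K) (w.adicCompletionIntegers K) x ∈
        Ideal.span {(p : w.adicCompletionIntegers K)}) :
    x ∈ Ideal.span {(p : 𝓞 K)} := by
  have hp0 : (p : 𝓞 K) ≠ 0 := by exact_mod_cast (Fact.out : p.Prime).ne_zero
  have hI : Ideal.span {(p : 𝓞 K)} ≠ 0 := by
    rw [Ne, Ideal.zero_eq_bot, Ideal.span_singleton_eq_bot]; exact hp0
  rw [← Ideal.iInf_maxPowDividing_eq hI, Submodule.mem_iInf]
  intro w
  change x ∈ w.asIdeal ^ (Associates.mk w.asIdeal).count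
    (Associates.mk (Ideal.span {(p : 𝓞 K)})).factors
  rw [← HeightOneSpectrum.intValuation_le_pow_iff_mem, ← w.intValuation_if_neg hp0]
  by_cases hw : (p : 𝓞 K) ∈ w.asIdeal
  · have h1 := h w hw
    rw [Ideal.mem_span_singleton] at h1
    have h2 := (Valuation.Integers.dvd_iff_le (Valuation.valuationSubring.integers _)).1 h1
    change Valued.v ((algebraMap (𝓞 K) (w.adicCompletionIntegers K) x : w.adicCompletion K)) ≤
      Valued.v (((p : w.adicCompletionIntegers K) : w.adicCompletionIntegers K) :
        w.adicCompletion K) at h2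
    rwa [valued_algebraMap_adicCompletionIntegers, valued_natCast_adicCompletionIntegers] at h2
  · have h1 : w.intValuation (p : 𝓞 K) = 1 := by
      have := (w.intValuation_lt_one_iff_mem (p : 𝓞 K)).not.2 hw
      exact le_antisymm (w.intValuation_le_one _) (not_lt.1 this)
    rw [h1]
    exact w.intValuation_le_one _

omit [Fact p.Prime] in
/-- `#(𝓞_K / p 𝓞_K) = p^{[K : ℚ]}` (`N(p) = p^{[K:ℚ]}`).  Ref: Neukirch, *Algebraic Number
Theory*, Ch. I (6.2) and §3. [folklore] -/
theorem card_quot_span_natCast :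
    Nat.card (𝓞 K ⧸ Ideal.span {(p : 𝓞 K)}) = p ^ Module.finrank ℚ K := by
  rw [← Submodule.cardQuot_apply, ← Ideal.absNorm_apply, Ideal.absNorm_span_singleton,
    ← map_natCast (algebraMap ℤ (𝓞 K)) p, Algebra.norm_algebraMap, RingOfIntegers.rank]
  simp only [Int.natAbs_pow, Int.natAbs_natCast]

/-- **`[K : ℚ] ≤ ∑_{v ∣ p} n_v`** where `p^{n_v} = #(𝒪_v / p)`: the natural map
`𝓞_K / p → ∏_{v ∈ T} 𝒪_v / p` is injective for any finite set `T` of places containing those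
above `p` (`mem_span_natCast_of_forall`), and `#(𝓞_K / p) = p^{[K:ℚ]}`.  This is (the inequality
used downstream of) `∑_{𝔭 ∣ p} [K_𝔭 : ℚ_p] = [K : ℚ]`.
Ref: Neukirch, *Algebraic Number Theory*, Ch. II (8.4); Washington, *Introduction to Cyclotomic
Fields*, §13.1, proof of Thm. 13.4. [folklore] -/
theorem finrank_le_sum (T : Finset (HeightOneSpectrum (𝓞 K)))
    (hT : ∀ w : HeightOneSpectrum (𝓞 K), (p : 𝓞 K) ∈ w.asIdeal → w ∈ T)
    (n : HeightOneSpectrum (𝓞 K) → ℕ)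
    (hn : ∀ w ∈ T, Nat.card (w.adicCompletionIntegers K ⧸
      Ideal.span {(p : w.adicCompletionIntegers K)}) = p ^ n w) :
    Module.finrank ℚ K ≤ ∑ w ∈ T, n w := by
  classical
  have hp : p.Prime := Fact.out
  -- the comparison map
  let f : 𝓞 K →+* ∀ w : T, (w.1.adicCompletionIntegers K ⧸
      Ideal.span {(p : w.1.adicCompletionIntegers K)}) :=
    RingHom.pi fun w => (Ideal.Quotient.mk _).comp (algebraMap (𝓞 K) (w.1.adicCompletionIntegers K))
  have hf_apply : ∀ (a : 𝓞 K) (w : T),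
      f a w = Ideal.Quotient.mk _ (algebraMap (𝓞 K) (w.1.adicCompletionIntegers K) a) :=
    fun a w => rfl
  have hf : ∀ a ∈ Ideal.span {(p : 𝓞 K)}, f a = 0 := fun a ha => by
    rw [Ideal.mem_span_singleton'] at ha
    obtain ⟨b, rfl⟩ := ha
    funext w
    rw [hf_apply, Pi.zero_apply, Ideal.Quotient.eq_zero_iff_mem, map_mul, map_natCast]
    exact Ideal.mul_mem_left _ _ (Ideal.mem_span_singleton_self _)
  let fbar : 𝓞 K ⧸ Ideal.span {(p : 𝓞 K)} →+* ∀ w : T, (w.1.adicCompletionIntegers K ⧸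
      Ideal.span {(p : w.1.adicCompletionIntegers K)}) :=
    Ideal.Quotient.lift (Ideal.span {(p : 𝓞 K)}) f hf
  have hinj : Function.Injective fbar := by
    rw [injective_iff_map_eq_zero]
    intro q hq
    obtain ⟨x, rfl⟩ := Ideal.Quotient.mk_surjective q
    have hq' : f x = 0 := by rwa [Ideal.Quotient.lift_mk] at hq
    rw [Ideal.Quotient.eq_zero_iff_mem]
    refine mem_span_natCast_of_forall K p x fun w hw => ?_
    have := congrFun hq' ⟨w, hT w hw⟩
    rw [hf_apply, Pi.zero_apply, Ideal.Quotient.eq_zero_iff_mem] at this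
    exact this
  -- count
  haveI : ∀ w : T, Finite (w.1.adicCompletionIntegers K ⧸
      Ideal.span {(p : w.1.adicCompletionIntegers K)}) := fun w =>
    Nat.finite_of_card_ne_zero (by rw [hn w.1 w.2]; exact pow_ne_zero _ hp.ne_zero)
  have hle := Nat.card_le_card_of_injective fbar hinj
  rw [card_quot_span_natCast, Nat.card_pi] at hle
  have hprod : ∏ w : T, Nat.card (w.1.adicCompletionIntegers K ⧸
      Ideal.span {(p : w.1.adicCompletionIntegers K)}) = p ^ ∑ w ∈ T, n w := by
    rw [← Finset.prod_pow_eq_pow_sum, ← Finset.prod_coe_sort T (fun w => p ^ n w)]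
    exact Fintype.prod_congr _ _ fun w => hn w.1 w.2
  rw [hprod] at hle
  exact (Nat.pow_le_pow_iff_right hp.one_lt).1 hle

/-! ### Separation and the exact rank at `v ∣ p` -/

/-- `⋂_m p^m 𝒪_v = 0` for `v ∣ p` (indeed for any `v`): a non-zero element has valuation
`|ϖ|^k` for some `k`, while `|p^m| ≤ |ϖ|^m → 0`. [folklore] -/
theorem eq_zero_of_forall_mem_span_pow (hv : (p : 𝓞 K) ∈ v.asIdeal)
    (a : v.adicCompletionIntegers K)
    (ha : ∀ m : ℕ, a ∈ Ideal.span {(p : v.adicCompletionIntegers K) ^ m}) : a = 0 := by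
  by_contra h0
  have hne : Valued.v ((a : v.adicCompletionIntegers K) : v.adicCompletion K) ≠ 0 := by
    intro h; exact h0 (Subtype.ext (by simpa using h))
  -- `|a| = exp k` with `k ≤ 0`
  obtain ⟨k, hk⟩ : ∃ k : ℤ, Valued.v ((a : v.adicCompletionIntegers K) : v.adicCompletion K) =
      WithZero.exp k := ⟨_, (WithZero.exp_log hne).symm⟩
  -- `|p| ≤ exp (-1)`
  have hp1 : Valued.v (((p : v.adicCompletionIntegers K) : v.adicCompletionIntegers K) :
      v.adicCompletion K) ≤ WithZero.exp (-1 : ℤ) := by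
    rw [valued_natCast_adicCompletionIntegers]
    have hlt := (v.intValuation_lt_one_iff_mem _).2 hv
    have hne' : v.intValuation (p : 𝓞 K) ≠ 0 :=
      v.intValuation_ne_zero _ (by exact_mod_cast (Fact.out : p.Prime).ne_zero)
    rw [← WithZero.exp_log hne', ← WithZero.exp_zero, WithZero.exp_lt_exp] at hlt
    rw [← WithZero.exp_log hne', WithZero.exp_le_exp]
    omega
  -- take `m = k.natAbs + 1`
  obtain ⟨b, hb⟩ := Ideal.mem_span_singleton'.1 (ha (k.natAbs + 1))
  have h1 : Valued.v ((a : v.adicCompletionIntegers K) : v.adicCompletion K) =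
      Valued.v ((b : v.adicCompletionIntegers K) : v.adicCompletion K) *
        Valued.v (((p : v.adicCompletionIntegers K) : v.adicCompletionIntegers K) :
          v.adicCompletion K) ^ (k.natAbs + 1) := by
    rw [← hb]; push_cast; rw [map_mul, map_pow]
  have hb1 : Valued.v ((b : v.adicCompletionIntegers K) : v.adicCompletion K) ≤ 1 := b.2
  have h2 : WithZero.exp k ≤ WithZero.exp (-1 : ℤ) ^ (k.natAbs + 1) := by
    rw [← hk, h1]
    calc Valued.v ((b : v.adicCompletionIntegers K) : v.adicCompletion K) *
          Valued.v (((p : v.adicCompletionIntegers K) : v.adicCompletionIntegers K) :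
            v.adicCompletion K) ^ (k.natAbs + 1)
        ≤ 1 * WithZero.exp (-1 : ℤ) ^ (k.natAbs + 1) :=
          mul_le_mul' hb1 (pow_le_pow_left₀ zero_le hp1 _)
      _ = _ := one_mul _
  rw [← WithZero.exp_nsmul, WithZero.exp_le_exp, nsmul_eq_mul, mul_neg, mul_one] at h2
  omega

/-- **`ℤ_p`-valued characters of `𝒪_vˣ`, `v ∣ p`, with the exact rank.**  As in
`exists_continuousMonoidHom_adicCompletionIntegers`, and moreover every continuous character
`ψ : 𝒪_vˣ → ℤ_p` satisfies `p^N ψ = ∑ cᵢ φᵢ`: `rank_{ℤ_p} Hom_cont(𝒪_vˣ, ℤ_p) = n_v`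
(`= [K_v : ℚ_p]`) exactly (abstract theorem `exists_forall_pow_mul_eq_sum`, the separation
`⋂ p^m 𝒪_v = 0` being `eq_zero_of_forall_mem_span_pow`).
Ref: Neukirch, *Algebraic Number Theory*, Ch. II (5.7) (i); Washington, *Introduction to
Cyclotomic Fields*, §13.1, proof of Thm. 13.4 (`rank_{ℤ_p} U_{1,𝔭} = [K_𝔭:ℚ_p]`). [folklore] -/
theorem exists_continuousMonoidHom_adicCompletionIntegers_rank (hv : (p : 𝓞 K) ∈ v.asIdeal) :
    ∃ (n N : ℕ) (φ : Fin n → ((v.adicCompletionIntegers K)ˣ →ₜ* Multiplicative ℤ_[p])),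
      Nat.card (v.adicCompletionIntegers K ⧸
        Ideal.span {(p : v.adicCompletionIntegers K)}) = p ^ n ∧
      (∀ x : Fin n → ℤ_[p], ∃ u : (v.adicCompletionIntegers K)ˣ, ∀ i,
        (φ i u).toAdd = (p : ℤ_[p]) ^ N * x i) ∧
      ∀ ψ : (v.adicCompletionIntegers K)ˣ →ₜ* Multiplicative ℤ_[p], ∃ c : Fin n → ℤ_[p],
        ∀ u : (v.adicCompletionIntegers K)ˣ,
          (p : ℤ_[p]) ^ N * (ψ u).toAdd = ∑ i, c i * (φ i u).toAdd := by
  haveI : CompactSpace (v.adicCompletionIntegers K) :=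
    Literature.NumberTheory.Automorphic.compactSpace_adicCompletionIntegers' K v
  refine exists_forall_pow_mul_eq_sum p (fun a ha => ?_)
    (isUnit_one_add_natCast_mul K v p hv) (fun m => ?_) (eq_zero_of_forall_mem_span_pow K v p hv)
  · exact (mul_eq_zero.1 ha).resolve_left (natCast_ne_zero_adicCompletionIntegers K v p)
  · refine IsDedekindDomain.isOpen_of_ne_bot ?_
    rw [Ne, Ideal.span_singleton_eq_bot]
    exact pow_ne_zero _ (natCast_ne_zero_adicCompletionIntegers K v p)

/-! ### `∑_{v ∣ p} n_v = [K : ℚ]` -/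

/-- **Density of `𝓞_K` in `𝒪_v` to any depth**: every `x ∈ 𝒪_v` is congruent modulo `𝔭_v^k`
to a global integer (induction on `k` with a global uniformiser, from the case `k = 1`,
`Literature.NumberTheory.Automorphic.exists_ringOfIntegers_valued_sub_lt_one`).  Ref: Neukirch, *Algebraic Number
Theory*, Ch. II §3 (the completion of `𝓞` at `𝔭`). [folklore] -/
theorem exists_ringOfIntegers_valued_sub_le (x : v.adicCompletionIntegers K) (k : ℕ) :
    ∃ a : 𝓞 K, Valued.v ((x : v.adicCompletion K) -
      (algebraMap (𝓞 K) (v.adicCompletionIntegers K) a : v.adicCompletion K)) ≤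
        WithZero.exp (-(k : ℤ)) := by
  obtain ⟨π, hπ⟩ := v.intValuation_exists_uniformizer
  have hπv : Valued.v ((algebraMap (𝓞 K) (v.adicCompletionIntegers K) π : v.adicCompletion K)) =
      WithZero.exp (-1 : ℤ) := by
    rw [valued_algebraMap_adicCompletionIntegers, hπ]
  induction k with
  | zero =>
    refine ⟨0, ?_⟩
    rw [map_zero, ZeroMemClass.coe_zero, sub_zero, Nat.cast_zero, neg_zero, WithZero.exp_zero]
    exact x.2
  | succ k ih =>
    obtain ⟨a, ha⟩ := ih
    -- `x - a = π^k z` with `z ∈ 𝒪_v`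
    set y : v.adicCompletionIntegers K := x - algebraMap (𝓞 K) (v.adicCompletionIntegers K) a
      with hy_def
    have hy : Valued.v ((y : v.adicCompletionIntegers K) : v.adicCompletion K) ≤
        Valued.v (((algebraMap (𝓞 K) (v.adicCompletionIntegers K) π ^ k :
          v.adicCompletionIntegers K)) : v.adicCompletion K) := by
      push_cast
      rw [map_pow, hπv, ← WithZero.exp_nsmul, nsmul_eq_mul, mul_neg, mul_one]
      exact ha
    have hdvd : (algebraMap (𝓞 K) (v.adicCompletionIntegers K) π ^ k : v.adicCompletionIntegers K) ∣ y :=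
      (Valuation.Integers.dvd_iff_le (Valuation.valuationSubring.integers _)).2 hy
    obtain ⟨z, hz⟩ := hdvd
    -- approximate `z` to depth one
    obtain ⟨c, hc⟩ := Literature.NumberTheory.Automorphic.exists_ringOfIntegers_valued_sub_lt_one K v z
    refine ⟨a + π ^ k * c, ?_⟩
    have hxz : (x : v.adicCompletion K) -
        (algebraMap (𝓞 K) (v.adicCompletionIntegers K) (a + π ^ k * c) : v.adicCompletion K) =
        ((algebraMap (𝓞 K) (v.adicCompletionIntegers K) π : v.adicCompletion K)) ^ k *
          ((z : v.adicCompletion K) -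
            (algebraMap (𝓞 K) (v.adicCompletionIntegers K) c : v.adicCompletion K)) := by
      have h1 : ((y : v.adicCompletionIntegers K) : v.adicCompletion K) =
          ((algebraMap (𝓞 K) (v.adicCompletionIntegers K) π : v.adicCompletion K)) ^ k *
            (z : v.adicCompletion K) := by
        rw [hz]; push_cast; rfl
      rw [map_add, map_mul, map_pow]
      push_cast
      rw [mul_sub, ← h1, hy_def]
      push_cast
      ring
    rw [hxz, map_mul, map_pow, hπv, ← WithZero.exp_nsmul]
    have hc' : Valued.v ((z : v.adicCompletion K) -
        (algebraMap (𝓞 K) (v.adicCompletionIntegers K) c : v.adicCompletion K)) ≤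
        WithZero.exp (-1 : ℤ) := by
      rw [Valuation.map_sub_swap]
      have hne : Valued.v ((algebraMap (𝓞 K) (v.adicCompletionIntegers K) c : v.adicCompletion K) -
          (z : v.adicCompletion K)) < WithZero.exp 0 := by
        rw [WithZero.exp_zero, HeightOneSpectrum.algebraMap_adicCompletionIntegers_apply]
        exact hc
      by_cases h0 : Valued.v ((algebraMap (𝓞 K) (v.adicCompletionIntegers K) c : v.adicCompletion K) -
          (z : v.adicCompletion K)) = 0
      · rw [h0]; exact zero_le
      · rw [← WithZero.exp_log h0, WithZero.exp_lt_exp] at hne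
        rw [← WithZero.exp_log h0, WithZero.exp_le_exp]
        omega
    calc WithZero.exp ((k : ℕ) • (-1 : ℤ)) * Valued.v ((z : v.adicCompletion K) -
          (algebraMap (𝓞 K) (v.adicCompletionIntegers K) c : v.adicCompletion K))
        ≤ WithZero.exp ((k : ℕ) • (-1 : ℤ)) * WithZero.exp (-1 : ℤ) := mul_le_mul' le_rfl hc'
      _ = WithZero.exp (-((k + 1 : ℕ) : ℤ)) := by
          rw [← WithZero.exp_add]; congr 1; push_cast; ring

/-- **`𝓞_K → ∏_{w ∈ T} 𝒪_w / p` is onto** for every finite set `T` of finite places (density to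
depth `e_w` at each `w`, then the Chinese remainder theorem in `𝓞_K`).  Ref: Neukirch,
*Algebraic Number Theory*, Ch. II (8.4) (via Ch. I (3.6) and II §3). [folklore] -/
theorem exists_forall_algebraMap_sub_mem (T : Finset (HeightOneSpectrum (𝓞 K)))
    (y : ∀ w : T, w.1.adicCompletionIntegers K) :
    ∃ a : 𝓞 K, ∀ w : T, algebraMap (𝓞 K) (w.1.adicCompletionIntegers K) a - y w ∈
      Ideal.span {(p : w.1.adicCompletionIntegers K)} := by
  classical
  have hp0 : (p : 𝓞 K) ≠ 0 := by exact_mod_cast (Fact.out : p.Prime).ne_zero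
  -- the exponents `e_w` with `|p|_w = |ϖ_w|^{e_w}`
  let e : HeightOneSpectrum (𝓞 K) → ℕ := fun w =>
    (Associates.mk w.asIdeal).count (Associates.mk (Ideal.span {(p : 𝓞 K)})).factors
  have he : ∀ w : HeightOneSpectrum (𝓞 K), w.intValuation (p : 𝓞 K) = WithZero.exp (-(e w : ℤ)) :=
    fun w => w.intValuation_if_neg hp0
  -- local approximations
  choose a ha using fun w : T => exists_ringOfIntegers_valued_sub_le K w.1 (y w) (e w.1)
  -- Chinese remainder theorem
  obtain ⟨b, hb⟩ := IsDedekindDomain.exists_forall_sub_mem_ideal (s := T)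
    (fun w : HeightOneSpectrum (𝓞 K) => w.asIdeal) e (fun w _ => w.prime)
    (fun w _ w' _ hww' heq => hww' (HeightOneSpectrum.ext heq)) (fun w => a w)
  refine ⟨b, fun w => ?_⟩
  rw [Ideal.mem_span_singleton]
  refine (Valuation.Integers.dvd_iff_le (Valuation.valuationSubring.integers _)).2 ?_
  change Valued.v (((algebraMap (𝓞 K) (w.1.adicCompletionIntegers K) b - y w :
      w.1.adicCompletionIntegers K)) : w.1.adicCompletion K) ≤
    Valued.v (((p : w.1.adicCompletionIntegers K) : w.1.adicCompletionIntegers K) :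
      w.1.adicCompletion K)
  rw [valued_natCast_adicCompletionIntegers, he, AddSubgroupClass.coe_sub]
  -- `b - y = (b - a) + (a - y)`
  have h1 : Valued.v ((algebraMap (𝓞 K) (w.1.adicCompletionIntegers K) (b - a w) :
      w.1.adicCompletion K)) ≤ WithZero.exp (-(e w.1 : ℤ)) := by
    rw [valued_algebraMap_adicCompletionIntegers, HeightOneSpectrum.intValuation_le_pow_iff_mem]
    exact hb w.1 w.2
  have h2 := ha w
  rw [Valuation.map_sub_swap] at h2
  have : ((algebraMap (𝓞 K) (w.1.adicCompletionIntegers K) b : w.1.adicCompletionIntegers K) :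
      w.1.adicCompletion K) - ((y w : w.1.adicCompletionIntegers K) : w.1.adicCompletion K) =
      ((algebraMap (𝓞 K) (w.1.adicCompletionIntegers K) (b - a w) : w.1.adicCompletionIntegers K) :
        w.1.adicCompletion K) +
      (((algebraMap (𝓞 K) (w.1.adicCompletionIntegers K) (a w) : w.1.adicCompletionIntegers K) :
        w.1.adicCompletion K) - ((y w : w.1.adicCompletionIntegers K) : w.1.adicCompletion K)) := by
    rw [map_sub, AddSubgroupClass.coe_sub]; ring
  rw [this]
  exact (Valuation.map_add _ _ _).trans (max_le h1 h2)

/-- **`∑_{v ∣ p} n_v = [K : ℚ]`** where `p^{n_v} = #(𝒪_v / p)`, for any finite set `T` of places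
containing those above `p` (places `w ∤ p` in `T` contribute `n_w = 0`): the natural map
`𝓞_K / p → ∏_{w ∈ T} 𝒪_w / p` is bijective (`mem_span_natCast_of_forall`,
`exists_forall_algebraMap_sub_mem`) and `#(𝓞_K/p) = p^{[K:ℚ]}`.  This is
`∑_{𝔭 ∣ p} [K_𝔭 : ℚ_p] = ∑ e_𝔭 f_𝔭 = [K : ℚ]`.
Ref: Neukirch, *Algebraic Number Theory*, Ch. II (8.4); Washington, *Introduction to Cyclotomic
Fields*, §13.1. [folklore] -/
theorem sum_eq_finrank (T : Finset (HeightOneSpectrum (𝓞 K)))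
    (hT : ∀ w : HeightOneSpectrum (𝓞 K), (p : 𝓞 K) ∈ w.asIdeal → w ∈ T)
    (n : HeightOneSpectrum (𝓞 K) → ℕ)
    (hn : ∀ w ∈ T, Nat.card (w.adicCompletionIntegers K ⧸
      Ideal.span {(p : w.adicCompletionIntegers K)}) = p ^ n w) :
    ∑ w ∈ T, n w = Module.finrank ℚ K := by
  classical
  have hp : p.Prime := Fact.out
  refine le_antisymm ?_ (finrank_le_sum K p T hT n hn)
  -- the comparison map is onto
  let f : 𝓞 K → ∀ w : T, (w.1.adicCompletionIntegers K ⧸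
      Ideal.span {(p : w.1.adicCompletionIntegers K)}) :=
    fun a w => Ideal.Quotient.mk _ (algebraMap (𝓞 K) (w.1.adicCompletionIntegers K) a)
  have hf : Function.Surjective f := fun q => by
    choose y hy using fun w : T => Ideal.Quotient.mk_surjective (q w)
    obtain ⟨a, ha⟩ := exists_forall_algebraMap_sub_mem K p T y
    refine ⟨a, funext fun w => ?_⟩
    rw [← hy w]
    exact (Ideal.Quotient.eq.2 (ha w))
  -- it factors through `𝓞_K / p`
  have hfact : ∀ a b : 𝓞 K, Ideal.Quotient.mk (Ideal.span {(p : 𝓞 K)}) a =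
      Ideal.Quotient.mk (Ideal.span {(p : 𝓞 K)}) b → f a = f b := by
    intro a b hab
    rw [Ideal.Quotient.eq, Ideal.mem_span_singleton'] at hab
    obtain ⟨c, hc⟩ := hab
    funext w
    refine Ideal.Quotient.eq.2 ?_
    rw [← map_sub, ← hc, map_mul, map_natCast]
    exact Ideal.mul_mem_left _ _ (Ideal.mem_span_singleton_self _)
  let g : 𝓞 K ⧸ Ideal.span {(p : 𝓞 K)} → ∀ w : T, (w.1.adicCompletionIntegers K ⧸
      Ideal.span {(p : w.1.adicCompletionIntegers K)}) :=
    Quotient.lift f fun a b (hab : (QuotientAddGroup.leftRel _) a b) => hfact a b (Quotient.sound hab)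
  have hg : Function.Surjective g := fun q => by
    obtain ⟨a, rfl⟩ := hf q
    exact ⟨Ideal.Quotient.mk _ a, rfl⟩
  haveI : Finite (𝓞 K ⧸ Ideal.span {(p : 𝓞 K)}) :=
    Nat.finite_of_card_ne_zero (by rw [card_quot_span_natCast]; exact pow_ne_zero _ hp.ne_zero)
  have hle := Nat.card_le_card_of_surjective g hg
  rw [card_quot_span_natCast, Nat.card_pi] at hle
  have hprod : ∏ w : T, Nat.card (w.1.adicCompletionIntegers K ⧸
      Ideal.span {(p : w.1.adicCompletionIntegers K)}) = p ^ ∑ w ∈ T, n w := by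
    rw [← Finset.prod_pow_eq_pow_sum, ← Finset.prod_coe_sort T (fun w => p ^ n w)]
    exact Fintype.prod_congr _ _ fun w => hn w.1 w.2
  rw [hprod] at hle
  exact (Nat.pow_le_pow_iff_right hp.one_lt).1 hle


end OneUnits

end Literature.NumberTheory.GaloisRepresentations
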